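import Literature.MathematicalPhysics.QuantumLattice.GrassmannCumulantKernelBound
import HarnessLib

/-!
# The vacuum (constant-part) bound for the truncated expectation: one INPUT field pinned, a volume factor

Topic `Literature/MathematicalPhysics/QuantumLattice`; the degree-`0` companion of `GrassmannLaplacianTruncatedBound.lean`
(Benfatto–Giuliani–Mastropietro 2006, (2.77)–(2.80) with `2l = 0`: the free-energy / normalisation terms).  There the
output slot `i` was pinned; for the constant part there is no output field, so one pins the FIRST FIELD OF THE ROOT
VERTEX instead and pays the volume `|Γ|` for its position — the bound is extensive, as it must be:

* `sum_filter_kerProd_mul_patWeight_laps_le` — the label sum of one pattern with a root position pinned;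
* `sum_filter_norm_kernel_zero_treeFactor_le` — one script, `r = 0`, root position pinned;
* **`norm_kernel_zero_ursellOf_kernelVertex_le`** — `‖kernel_0 𝓔ᵀ‖ ≤ |Γ| · κ^{N-2(n-1)} (∏ N_v) · λ^{-(n-1)} ∏_ℓ (1 + λ α m m'_ℓ)`;
* `ursellOf_convMoment_eq_zero_of_eq_zero` — a vanishing vertex kills the truncated expectation;
* **`norm_constPart_cumulantOf_le`** — the cumulant form: `|constPart 𝓔ᵀ_C(V;n)| ≤ n |Γ| Σ_δ [2(n-1) ≤ N_δ] cumulantBound(r = 0)`.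

Everything is proved; no named fact.

## Sources

G. Benfatto, A. Giuliani, V. Mastropietro, Ann. Henri Poincaré 7 (2006) 809–898, (2.77)–(2.80)
(`BenfattoGiulianiMastropietro2006`); K. Gawȩdzki, A. Kupiainen, Comm. Math. Phys. 102 (1985) 1–30, §3
(`GawedzkiKupiainen1985GrossNeveu`).
-/

noncomputable section

namespace Literature.MathematicalPhysics.QuantumLattice

open GrassmannAlgebra Finset MvPolynomial Literature.RingTheory.MvPolynomial
open Literature.Probability.LatticeModels Literature.Probability.LatticeModels.BattleFederbush
open Literature.MeasureTheory.Integral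
open scoped InnerProductSpace

variable {𝕜 : Type*} [RCLike 𝕜] {Γ : Type*} [Fintype Γ] [DecidableEq Γ] {n : ℕ}
variable (C : Matrix Γ Γ 𝕜) (cl : Γ → Fin n) {deg : Fin n → ℕ} (K : ∀ v : Fin n, (Fin (deg v) → Γ) → 𝕜)

omit [Fintype Γ] [DecidableEq Γ] in
/-- With no output fields the operations of a script are its Laplacians. [folklore] -/
theorem scriptOps_elim0 {v : Fin n} {k : ℕ} (s : Script v k) :
    scriptOps C cl (Fin.elim0 : Fin 0 → Γ) s = s.lines.reverse.map fun ℓ => DelOp.lap (typeRestrict C cl ℓ) := by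
  rw [scriptOps, List.ofFn_zero, List.map_nil, List.nil_append]

/-- **One pattern, a root position pinned**: `Σ_{x : x_{p₀} = w} ∏‖K‖ weight(x, Δ's, π) ≤ [π consistent] (α/2)^k ∏ N_u`. [folklore] -/
theorem sum_filter_kerProd_mul_patWeight_laps_le (hK : ∀ v Yv, K v Yv ≠ 0 → ∀ j, cl (Yv j) = v)
    (Nv : Fin n → ℝ) (hN0 : ∀ u, 0 ≤ Nv u)
    (hN : ∀ u (j : Fin (deg u)) (a : Γ), ∑ Yu ∈ univ.filter (fun Yu : Fin (deg u) → Γ => Yu j = a), ‖K u Yu‖ ≤ Nv u)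
    {α : ℝ} (hα : 0 ≤ α) (hrow : ∀ ℓ X, ∑ Y, ‖typeRestrict C cl ℓ X Y‖ ≤ α) (hcol : ∀ ℓ Y, ∑ X, ‖typeRestrict C cl ℓ X Y‖ ≤ α)
    {v₀ : Fin n} {k : ℕ} (s : Script v₀ k) (hs : s.Valid) (hcov : univ.image s.y = univ)
    (π : List (Fin (∑ v, deg v) × Fin (∑ v, deg v))) (p₀ : Fin (∑ v, deg v)) (hp₀ : vert deg p₀ = v₀) (w : Γ) :
    ∑ x ∈ univ.filter (fun x : Fin (∑ v, deg v) → Γ => x p₀ = w),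
        kerProd K x * patWeight x (s.lines.reverse.map fun ℓ => (DelOp.lap (typeRestrict C cl ℓ) : DelOp Γ 𝕜)) π ≤
      (if stepsOK (s.lines.reverse.map (lapPred deg)) π then 1 else 0) * ((α / 2) ^ k * ∏ u, Nv u) := by
  rw [sum_congr rfl fun x _ => kerProd_mul_patWeight_laps C cl K hK x _ π]
  by_cases hc : stepsOK (s.lines.reverse.map (lapPred deg)) π = true
  · rw [if_pos hc, one_mul]
    exact sum_kerProd_mul_lapWt_le C cl K Nv hN0 hN hα hrow hcol s hs hcov π p₀ hp₀ w
  · rw [if_neg hc, zero_mul]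
    refine le_of_eq (sum_eq_zero fun x _ => ?_)
    rw [lapWt_eq C cl x _ _ (List.nodup_reverse.2 (Script.nodup_lines s hs)), if_neg hc, mul_zero]

/-- **One script, no output fields, the first field `j₀` of the root vertex pinned at `w`**:
`Σ_{Y : Y_{v₀}(j₀) = w} ∏‖K‖ ‖kernel_0 (treeFactor s ψ(flat Y))‖ ≤ κ^{N-2k} (∏ N_u) (∏_{ℓ ∈ lines} α m m'_ℓ) ∫ w_s`.
[cite: BenfattoGiulianiMastropietro2006, (2.77)] -/
theorem sum_filter_norm_kernel_zero_treeFactor_le {E : Type*} [NormedAddCommGroup E] [InnerProductSpace 𝕜 E]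
    (q : Γ → Bool) (hC : ∀ X Y, q X = q Y → C X Y = 0) (f g : Γ → E) {κ : ℝ} (hκ : 0 ≤ κ)
    (hf : ∀ X, q X = true → ‖f X‖ ≤ κ) (hg : ∀ Y, q Y = false → ‖g Y‖ ≤ κ)
    (hG : ∀ X Y, q X = true → q Y = false → contr 𝕜 C X Y = ⟪f X, g Y⟫_𝕜)
    (hK : ∀ v Yv, K v Yv ≠ 0 → ∀ j, cl (Yv j) = v) (Nv : Fin n → ℝ) (hN0 : ∀ u, 0 ≤ Nv u)
    (hN : ∀ u (j : Fin (deg u)) (a : Γ), ∑ Yu ∈ univ.filter (fun Yu : Fin (deg u) → Γ => Yu j = a), ‖K u Yu‖ ≤ Nv u)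
    {α : ℝ} (hα : 0 ≤ α) (hrow : ∀ ℓ X, ∑ Y, ‖typeRestrict C cl ℓ X Y‖ ≤ α) (hcol : ∀ ℓ Y, ∑ X, ‖typeRestrict C cl ℓ X Y‖ ≤ α)
    {v₀ : Fin n} (j₀ : Fin (deg v₀)) {k : ℕ} (s : Script v₀ k) (hs : s.Valid) (hcov : univ.image s.y = univ) (w : Γ) :
    ∑ Ys ∈ univ.filter (fun Ys : (∀ v, Fin (deg v) → Γ) => Ys v₀ j₀ = w), (∏ u, ‖K u (Ys u)‖) *
        ‖kernel 𝕜 (((Script.treeFactor (pairLap 𝕜 C cl) s : laplacianAlgebra 𝕜 C cl) : Module.End 𝕜 (GrassmannAlgebra 𝕜 Γ))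
          (genProd 𝕜 (flat Ys))) 0 Fin.elim0‖ ≤
      (κ ^ ((∑ v, deg v) - 2 * k) * ∏ u, Nv u) * ((s.lines.map fun ℓ => α * (pairDeg deg ℓ : ℝ)).prod * cubeIntegral (Fin n) ℝ (s.weight ℝ)) := by
  set laps : List (DelOp Γ 𝕜) := s.lines.reverse.map fun ℓ => DelOp.lap (typeRestrict C cl ℓ) with hlaps
  set P := patSet laps (univ : Finset (Fin (∑ v, deg v))) with hP
  set Iw := cubeIntegral (Fin n) ℝ (s.weight ℝ) with hIw
  set e := (∑ v, deg v) - 2 * k with he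
  set D := (α / 2) ^ k * ∏ u, Nv u with hD
  set p₀ : Fin (∑ v, deg v) := blockEmb deg v₀ j₀ with hp₀
  have hIw0 : 0 ≤ Iw := cubeIntegral_nonneg _ fun t ht => FermionicTree.eval_weight_nonneg s ht
  have hD0 : 0 ≤ D := mul_nonneg (pow_nonneg (by positivity) _) (prod_nonneg fun u _ => hN0 u)
  have hG0 : ∀ Ys : ∀ v, Fin (deg v) → Γ, 0 ≤ ∏ u, ‖K u (Ys u)‖ := fun Ys => prod_nonneg fun u _ => norm_nonneg _
  -- the Gram bound per label family
  have h1 : ∀ Ys : ∀ v, Fin (deg v) → Γ, (∏ u, ‖K u (Ys u)‖) *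
      ‖kernel 𝕜 (((Script.treeFactor (pairLap 𝕜 C cl) s : laplacianAlgebra 𝕜 C cl) : Module.End 𝕜 (GrassmannAlgebra 𝕜 Γ))
        (genProd 𝕜 (flat Ys))) 0 Fin.elim0‖ ≤
      ∑ π ∈ P, (κ ^ e * Iw) * (kerProd K (flat Ys) * patWeight (flat Ys) laps π) := by
    intro Ys
    have h := norm_kernel_treeFactor_genProd_le C cl q hC f g hκ hf hg hG s hs (flat Ys) (Fin.elim0 : Fin 0 → Γ)
    rw [scriptOps_elim0, ← hlaps, ← hP, Nat.factorial_zero, Nat.cast_one, inv_one, one_mul, zero_add, ← he, ← hIw] at h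
    refine (mul_le_mul_of_nonneg_left h (hG0 Ys)).trans (le_of_eq ?_)
    rw [sum_mul, mul_sum, kerProd_flat]
    exact sum_congr rfl fun π _ => by ring
  -- count of the admissible patterns
  have hcount : ((P.filter fun π => stepsOK (s.lines.reverse.map (lapPred deg)) π).card : ℝ) ≤
      (((s.lines.reverse.map fun ℓ => 2 * pairDeg deg ℓ).prod : ℕ) : ℝ) := by
    set L : List (DelOp Γ 𝕜 × (Fin (∑ v, deg v) × Fin (∑ v, deg v) → Bool) × (ℕ → ℕ)) :=
      s.lines.reverse.map fun ℓ => (DelOp.lap (typeRestrict C cl ℓ), lapPred deg ℓ, fun _ => 2 * pairDeg deg ℓ) with hL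
    have hfst : L.map Prod.fst = laps := by rw [hL, hlaps, List.map_map]; rfl
    have hpred : L.map (fun x => x.2.1) = s.lines.reverse.map (lapPred deg) := by rw [hL, List.map_map]; rfl
    have hbd : L.map (fun x => (x.1, x.2.2)) = s.lines.reverse.map fun ℓ => ((DelOp.lap (typeRestrict C cl ℓ) : DelOp Γ 𝕜), fun _ => 2 * pairDeg deg ℓ) := by
      rw [hL, List.map_map]; rfl
    have hB : ∀ x ∈ L, ∀ S' : Finset (Fin (∑ v, deg v)), ((DelOp.stepSet S' x.1).filter fun pq => x.2.1 pq).card ≤ x.2.2 S'.card := by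
      intro x hx S'
      rw [hL, List.mem_map] at hx
      obtain ⟨ℓ, -, rfl⟩ := hx
      exact card_filter_lapPred_le S' _ ℓ
    have h := card_filter_patSet_le L hB univ
    rw [hfst, hpred, hbd, countBound_consts] at h
    exact_mod_cast h
  have hprod : (s.lines.map fun ℓ => α * (pairDeg deg ℓ : ℝ)).prod =
      (α / 2) ^ k * (((s.lines.reverse.map fun ℓ => 2 * pairDeg deg ℓ).prod : ℕ) : ℝ) := by
    rw [Nat.cast_list_prod, List.map_map, List.map_reverse, List.prod_reverse,
      show (fun ℓ => α * (pairDeg deg ℓ : ℝ)) = fun ℓ => (α / 2) * ((Nat.cast : ℕ → ℝ) ∘ fun ℓ => 2 * pairDeg deg ℓ) ℓ from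
        funext fun ℓ => by simp only [Function.comp_apply, Nat.cast_mul, Nat.cast_ofNat]; ring,
      List.prod_map_mul, List.map_const', List.prod_replicate, Script.length_lines]
  -- the pinned label sum of one pattern, reindexed by position labellings
  have hpin : ∀ π ∈ P, ∑ Ys ∈ univ.filter (fun Ys : (∀ v, Fin (deg v) → Γ) => Ys v₀ j₀ = w),
      kerProd K (flat Ys) * patWeight (flat Ys) laps π ≤ (if stepsOK (s.lines.reverse.map (lapPred deg)) π then 1 else 0) * D := by
    intro π _
    have heq : ∑ Ys ∈ univ.filter (fun Ys : (∀ v, Fin (deg v) → Γ) => Ys v₀ j₀ = w), kerProd K (flat Ys) * patWeight (flat Ys) laps π =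
        ∑ x ∈ univ.filter (fun x : Fin (∑ v, deg v) → Γ => x p₀ = w), kerProd K x * patWeight x laps π := by
      refine sum_equiv (flatEquiv deg) (fun Ys => ?_) (fun Ys _ => rfl)
      simp only [mem_filter, mem_univ, true_and, flatEquiv_apply, hp₀, flat_blockEmb]
    rw [heq]
    exact sum_filter_kerProd_mul_patWeight_laps_le C cl K hK Nv hN0 hN hα hrow hcol s hs hcov π p₀ (vert_blockEmb deg v₀ j₀) w
  calc ∑ Ys ∈ univ.filter (fun Ys : (∀ v, Fin (deg v) → Γ) => Ys v₀ j₀ = w), (∏ u, ‖K u (Ys u)‖) *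
          ‖kernel 𝕜 (((Script.treeFactor (pairLap 𝕜 C cl) s : laplacianAlgebra 𝕜 C cl) : Module.End 𝕜 (GrassmannAlgebra 𝕜 Γ))
            (genProd 𝕜 (flat Ys))) 0 Fin.elim0‖
      ≤ ∑ Ys ∈ univ.filter (fun Ys : (∀ v, Fin (deg v) → Γ) => Ys v₀ j₀ = w),
          ∑ π ∈ P, (κ ^ e * Iw) * (kerProd K (flat Ys) * patWeight (flat Ys) laps π) := sum_le_sum fun Ys _ => h1 Ys
    _ = (κ ^ e * Iw) * ∑ π ∈ P, ∑ Ys ∈ univ.filter (fun Ys : (∀ v, Fin (deg v) → Γ) => Ys v₀ j₀ = w),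
          kerProd K (flat Ys) * patWeight (flat Ys) laps π := by
        rw [sum_comm, mul_sum]
        exact sum_congr rfl fun π _ => by rw [mul_sum]
    _ ≤ (κ ^ e * Iw) * ∑ π ∈ P, (if stepsOK (s.lines.reverse.map (lapPred deg)) π then 1 else 0) * D :=
        mul_le_mul_of_nonneg_left (sum_le_sum hpin) (by positivity)
    _ = (κ ^ e * Iw) * (((P.filter fun π => stepsOK (s.lines.reverse.map (lapPred deg)) π).card : ℝ) * D) := by
        rw [← sum_mul, ← sum_boole]
    _ ≤ (κ ^ e * Iw) * ((((s.lines.reverse.map fun ℓ => 2 * pairDeg deg ℓ).prod : ℕ) : ℝ) * D) :=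
        mul_le_mul_of_nonneg_left (mul_le_mul_of_nonneg_right hcount hD0) (by positivity)
    _ = (κ ^ e * ∏ u, Nv u) * ((s.lines.map fun ℓ => α * (pairDeg deg ℓ : ℝ)).prod * Iw) := by
        rw [hprod, hD]
        ring

/-- **The vacuum bound** (Benfatto–Giuliani–Mastropietro 2006, (2.77)–(2.80) with no external legs): for `n` even
kernel vertices supported on their clusters, a root vertex `v₀` with a field `j₀`, and any `λ > 0`,
`‖kernel_0 𝓔ᵀ_C(M_0,…,M_{n-1})‖ ≤ |Γ| · κ^{N-2(n-1)} (∏_v N_v) · λ^{-(n-1)} ∏_ℓ (1 + λ α m m'_ℓ)` — the position of the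
pinned root field costs the volume. [cite: BenfattoGiulianiMastropietro2006, (2.77)-(2.80)] -/
theorem norm_kernel_zero_ursellOf_kernelVertex_le {E : Type*} [NormedAddCommGroup E] [InnerProductSpace 𝕜 E]
    (q : Γ → Bool) (hC : ∀ X Y, q X = q Y → C X Y = 0) (f g : Γ → E) {κ : ℝ} (hκ : 0 ≤ κ)
    (hf : ∀ X, q X = true → ‖f X‖ ≤ κ) (hg : ∀ Y, q Y = false → ‖g Y‖ ≤ κ)
    (hG : ∀ X Y, q X = true → q Y = false → contr 𝕜 C X Y = ⟪f X, g Y⟫_𝕜)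
    (hm : ∀ v, Even (deg v)) (hK : ∀ v Yv, K v Yv ≠ 0 → ∀ j, cl (Yv j) = v) (Nv : Fin n → ℝ) (hN0 : ∀ u, 0 ≤ Nv u)
    (hN : ∀ u (j : Fin (deg u)) (a : Γ), ∑ Yu ∈ univ.filter (fun Yu : Fin (deg u) → Γ => Yu j = a), ‖K u Yu‖ ≤ Nv u)
    {α : ℝ} (hα : 0 ≤ α) (hrow : ∀ ℓ X, ∑ Y, ‖typeRestrict C cl ℓ X Y‖ ≤ α) (hcol : ∀ ℓ Y, ∑ X, ‖typeRestrict C cl ℓ X Y‖ ≤ α) {lam : ℝ} (hlam : 0 < lam)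
    (v₀ : Fin n) (j₀ : Fin (deg v₀)) :
    ‖kernel 𝕜 ((ursellOf (convMoment 𝕜 C (kernelVertex 𝕜 hm K)) univ : evenPart 𝕜 Γ) : GrassmannAlgebra 𝕜 Γ) 0 Fin.elim0‖ ≤
      (Fintype.card Γ : ℝ) * ((κ ^ ((∑ v, deg v) - 2 * (n - 1)) * ∏ u, Nv u) *
        ((lam⁻¹) ^ (n - 1) * ∏ ℓ : Sym2 (Fin n), (1 + lam * (α * (pairDeg deg ℓ : ℝ))))) := by
  have hn : 0 < n := Fin.pos v₀
  set y : Sym2 (Fin n) → ℝ := fun ℓ => α * (pairDeg deg ℓ : ℝ) with hy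
  have hy0 : ∀ ℓ, 0 ≤ y ℓ := fun ℓ => mul_nonneg hα (Nat.cast_nonneg _)
  have hNv : 0 ≤ ∏ u, Nv u := prod_nonneg fun u _ => hN0 u
  set T : ∀ k : ℕ, Script v₀ k → (∀ v, Fin (deg v) → Γ) → ℝ := fun k s Ys =>
    ‖kernel 𝕜 (((Script.treeFactor (pairLap 𝕜 C cl) s : laplacianAlgebra 𝕜 C cl) : Module.End 𝕜 (GrassmannAlgebra 𝕜 Γ))
      (genProd 𝕜 (flat Ys))) 0 Fin.elim0‖ with hT
  set B : ℕ → ℝ := fun k => κ ^ ((∑ v, deg v) - 2 * k) * ∏ u, Nv u with hB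
  have hB0 : ∀ k, 0 ≤ B k := fun k => mul_nonneg (pow_nonneg hκ _) hNv
  calc ‖kernel 𝕜 ((ursellOf (convMoment 𝕜 C (kernelVertex 𝕜 hm K)) univ : evenPart 𝕜 Γ) : GrassmannAlgebra 𝕜 Γ) 0 Fin.elim0‖
      ≤ ∑ Ys : (∀ v, Fin (deg v) → Γ), (∏ u, ‖K u (Ys u)‖) * ∑ k ∈ range n, ∑ s : Script v₀ k,
          if s.Valid ∧ univ.image s.y = univ then T k s Ys else 0 :=
        norm_kernel_ursellOf_kernelVertex_le C cl K hm hK v₀ 0 Fin.elim0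
    _ = ∑ k ∈ range n, ∑ s : Script v₀ k, ∑ w : Γ, ∑ Ys ∈ univ.filter (fun Ys : (∀ v, Fin (deg v) → Γ) => Ys v₀ j₀ = w),
          (∏ u, ‖K u (Ys u)‖) * (if s.Valid ∧ univ.image s.y = univ then T k s Ys else 0) := by
        calc ∑ Ys : (∀ v, Fin (deg v) → Γ), (∏ u, ‖K u (Ys u)‖) * ∑ k ∈ range n, ∑ s : Script v₀ k,
                (if s.Valid ∧ univ.image s.y = univ then T k s Ys else 0)
            = ∑ Ys : (∀ v, Fin (deg v) → Γ), ∑ k ∈ range n, ∑ s : Script v₀ k,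
                (∏ u, ‖K u (Ys u)‖) * (if s.Valid ∧ univ.image s.y = univ then T k s Ys else 0) :=
              sum_congr rfl fun Ys _ => by
                rw [mul_sum]
                exact sum_congr rfl fun k _ => mul_sum _ _ _
          _ = ∑ k ∈ range n, ∑ Ys : (∀ v, Fin (deg v) → Γ), ∑ s : Script v₀ k,
                (∏ u, ‖K u (Ys u)‖) * (if s.Valid ∧ univ.image s.y = univ then T k s Ys else 0) := sum_comm
          _ = ∑ k ∈ range n, ∑ s : Script v₀ k, ∑ Ys : (∀ v, Fin (deg v) → Γ),
                (∏ u, ‖K u (Ys u)‖) * (if s.Valid ∧ univ.image s.y = univ then T k s Ys else 0) :=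
              sum_congr rfl fun k _ => sum_comm
          _ = _ := sum_congr rfl fun k _ => sum_congr rfl fun s _ =>
              (sum_fiberwise univ (fun Ys : (∀ v, Fin (deg v) → Γ) => Ys v₀ j₀) _).symm
    _ ≤ ∑ k ∈ range n, ∑ s : Script v₀ k, ∑ _w : Γ, (if s.Valid ∧ univ.image s.y = univ then
          B k * ((s.lines.map y).prod * cubeIntegral (Fin n) ℝ (s.weight ℝ)) else 0) := by
        refine sum_le_sum fun k _ => sum_le_sum fun s _ => sum_le_sum fun w _ => ?_
        split_ifs with h
        · exact sum_filter_norm_kernel_zero_treeFactor_le C cl K q hC f g hκ hf hg hG hK Nv hN0 hN hα hrow hcol j₀ s h.1 h.2 w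
        · simp
    _ = (Fintype.card Γ : ℝ) * ∑ k ∈ range n, ∑ s : Script v₀ k, (if s.Valid ∧ univ.image s.y = univ then
          B k * ((s.lines.map y).prod * cubeIntegral (Fin n) ℝ (s.weight ℝ)) else 0) := by
        rw [mul_sum]
        refine sum_congr rfl fun k _ => ?_
        rw [mul_sum]
        refine sum_congr rfl fun s _ => ?_
        rw [sum_const, card_univ, nsmul_eq_mul]
    _ = (Fintype.card Γ : ℝ) * ∑ s : Script v₀ (n - 1), (if s.Valid ∧ univ.image s.y = univ then
          B (n - 1) * ((s.lines.map y).prod * cubeIntegral (Fin n) ℝ (s.weight ℝ)) else 0) := by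
        rw [sum_eq_single (n - 1)]
        · intro k _ hk
          refine sum_eq_zero fun s _ => if_neg ?_
          rintro ⟨hs, hcov⟩
          have h := Script.card_image_y s hs
          rw [hcov, card_univ, Fintype.card_fin] at h
          omega
        · intro h
          exact absurd (mem_range.2 (by omega)) h
    _ ≤ (Fintype.card Γ : ℝ) * (B (n - 1) * ∑ s : Script v₀ (n - 1),
          (if s.Valid then (s.lines.map y).prod * cubeIntegral (Fin n) ℝ (s.weight ℝ) else 0)) := by
        refine mul_le_mul_of_nonneg_left ?_ (Nat.cast_nonneg _)
        rw [mul_sum]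
        refine sum_le_sum fun s _ => ?_
        have h0 := Script.prod_mul_weight_nonneg s y hy0
        by_cases hv : s.Valid
        · by_cases hc : univ.image s.y = univ
          · simp [hv, hc]
          · simp only [hv, hc, and_false, if_false, if_true]
            rw [if_pos hv] at h0
            exact mul_nonneg (hB0 _) h0
        · simp [hv]
    _ ≤ (Fintype.card Γ : ℝ) * (B (n - 1) * ((lam⁻¹) ^ (n - 1) * ∏ ℓ : Sym2 (Fin n), (1 + lam * y ℓ))) :=
        mul_le_mul_of_nonneg_left (mul_le_mul_of_nonneg_left
          (sum_prod_mul_weight_le_of_scale y hy0 v₀ hlam (by rw [Fintype.card_fin]; omega)) (hB0 _)) (Nat.cast_nonneg _)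

/-! ### The cumulant form: `|constPart 𝓔ᵀ_C(V; n)|` -/

section Cumulant

omit [DecidableEq Γ] in
/-- A vanishing vertex kills the truncated expectation. [folklore] -/
theorem ursellOf_convMoment_eq_zero_of_eq_zero {R : Type*} [CommRing R] [Algebra ℚ R] [DecidableEq Γ] {ι : Type*} [Fintype ι] [DecidableEq ι]
    (C : Matrix Γ Γ R) (cl : Γ → ι) {M : ι → evenPart R Γ} (hM : ∀ v, (M v : GrassmannAlgebra R Γ) ∈ fieldSubalgebra R (cl ⁻¹' {v}))
    {v₀ : ι} (h0 : M v₀ = 0) : ursellOf (convMoment R C M) univ = 0 := by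
  rw [ursellOf_convMoment_eq_treeOp R C cl hM univ (mem_univ v₀), prod_eq_zero (mem_univ v₀) h0, map_zero]

/-- `cumulantBound ≥ 0`. [folklore] -/
theorem cumulantBound_nonneg {κ α lam : ℝ} (hκ : 0 ≤ κ) (hα : 0 ≤ α) (hlam : 0 < lam) {N : ℕ → ℝ} (hN : ∀ m', 0 ≤ N m')
    (r : ℕ) (δ : Fin n → ℕ) : 0 ≤ cumulantBound n κ α lam N r δ := by
  rw [cumulantBound]
  refine mul_nonneg (mul_nonneg (mul_nonneg (by positivity) (pow_nonneg hκ _)) (prod_nonneg fun a _ => hN _))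
    (mul_nonneg (by positivity) (prod_nonneg fun ℓ _ => by positivity))

/-- **The vacuum bound for `𝓔ᵀ_C(V; n)`**: for `V = Σ_{m' ∈ degs} Σ_Y K_{m'}(Y) ψ(Y)` with vanishing degree-`0` kernel
(no constant term), anchored `L¹` norms `≤ N(m')`, a charged Gram covariance with constant `κ`, one-copy row and column
sums of `‖C‖` at most `α`, and any positive `λ_δ`:
`|constPart 𝓔ᵀ_C(V; n)| ≤ n |Γ| · Σ_δ [2(n-1) ≤ N_δ] cumulantBound(δ; r = 0)` (the volume of the pinned root field of the
`n|Γ|` replica labels). [cite: BenfattoGiulianiMastropietro2006, (2.77)-(2.80)] -/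
theorem norm_constPart_cumulantOf_le {E : Type*} [NormedAddCommGroup E] [InnerProductSpace 𝕜 E]
    (q : Γ → Bool) (hC : ∀ X Y, q X = q Y → C X Y = 0) (f g : Γ → E) {κ : ℝ} (hκ : 0 ≤ κ)
    (hf : ∀ X, q X = true → ‖f X‖ ≤ κ) (hg : ∀ Y, q Y = false → ‖g Y‖ ≤ κ)
    (hG : ∀ X Y, q X = true → q Y = false → contr 𝕜 C X Y = ⟪f X, g Y⟫_𝕜)
    (degs : Finset ℕ) (K : (m' : ℕ) → (Fin (2 * m') → Γ) → 𝕜) (hK0 : ∀ Y, K 0 Y = 0) (N : ℕ → ℝ) (hN0 : ∀ m', 0 ≤ N m')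
    (hN : ∀ m' (j : Fin (2 * m')) (w : Γ), ∑ Y ∈ univ.filter (fun Y : Fin (2 * m') → Γ => Y j = w), ‖K m' Y‖ ≤ N m')
    {α : ℝ} (hα : 0 ≤ α) (hrow : ∀ X, ∑ Y, ‖C X Y‖ ≤ α) (hcol : ∀ Y, ∑ X, ‖C X Y‖ ≤ α)
    (lam : (Fin n → ℕ) → ℝ) (hlam : ∀ δ, 0 < lam δ) (hn : 0 < n) :
    ‖constPart 𝕜 ((cumulantOf (fun k => evenGaussConv 𝕜 C (vertexOf 𝕜 degs K ^ k)) n : evenPart 𝕜 Γ) : GrassmannAlgebra 𝕜 Γ)‖ ≤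
      ((n : ℝ) * Fintype.card Γ) * ∑ δ ∈ Fintype.piFinset (fun _ : Fin n => degs),
        (if 2 * (n - 1) ≤ ∑ a, 2 * δ a then cumulantBound n κ α (lam δ) N 0 δ else 0) := by
  set C' : Matrix (Fin n × Γ) (Fin n × Γ) 𝕜 := C.submatrix Prod.snd Prod.snd with hC'
  have huniv : (univ : Finset (Fin n)).Nonempty := ⟨⟨0, hn⟩, mem_univ _⟩
  set U : (Fin n → ℕ) → evenPart 𝕜 (Fin n × Γ) := fun δ => ursellOf (convMoment 𝕜 C'
    (kernelVertex 𝕜 (deg := fun b : Fin n => 2 * δ b) (fun b => even_two_mul (δ b)) fun b => replicaKer 𝕜 (K (δ b)) b)) univ with hU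
  -- replicas, collapse, multilinearity (as in `sum_norm_kernel_cumulantOf_le`)
  have hcum : ((cumulantOf (fun k => evenGaussConv 𝕜 C (vertexOf 𝕜 degs K ^ k)) n : evenPart 𝕜 Γ) : GrassmannAlgebra 𝕜 Γ) =
      ∑ δ ∈ Fintype.piFinset (fun _ : Fin n => degs), collapse 𝕜 (Prod.snd : Fin n × Γ → Γ) (U δ : GrassmannAlgebra 𝕜 (Fin n × Γ)) := by
    have h1 := collapseEven_ursellOf_convMoment_eq_cumulantOf 𝕜 (Prod.snd : Fin n × Γ → Γ) C (replicaVertex 𝕜 degs K)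
      (vertexOf 𝕜 degs K) (collapseEven_replicaVertex 𝕜 degs K) huniv
    rw [card_univ, Fintype.card_fin] at h1
    rw [← h1, coe_collapseEven]
    have h2 : ursellOf (convMoment 𝕜 C' (replicaVertex 𝕜 degs K)) univ = ∑ δ ∈ Fintype.piFinset (fun _ : Fin n => degs), U δ :=
      ursellOf_convMoment_eq_sum_piFinset 𝕜 C' (Prod.fst : Fin n × Γ → Fin n) (fun _ : Fin n => degs)
        (fun a m' => kernelVertex 𝕜 (deg := fun _ : Fin n => 2 * m') (fun _ => even_two_mul m') (fun b => replicaKer 𝕜 (K m') b) a)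
        (fun a m' => coe_kernelVertex_replicaKer_mem 𝕜 m' (K m') a) ⟨0, hn⟩
    rw [← hC', h2, AddSubmonoidClass.coe_finsetSum, map_sum]
  -- transported data
  have hC'' : ∀ X' Y' : Fin n × Γ, q X'.2 = q Y'.2 → C' X' Y' = 0 := fun X' Y' h => hC _ _ h
  have hG' : ∀ X' Y' : Fin n × Γ, q X'.2 = true → q Y'.2 = false → contr 𝕜 C' X' Y' = ⟪f X'.2, g Y'.2⟫_𝕜 :=
    fun X' Y' h1 h2 => by rw [hC', contr_submatrix]; exact hG _ _ h1 h2
  -- the bound per degree assignment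
  have hδ : ∀ δ : Fin n → ℕ, ‖kernel 𝕜 (U δ : GrassmannAlgebra 𝕜 (Fin n × Γ)) 0 Fin.elim0‖ ≤
      ((n : ℝ) * Fintype.card Γ) * (if 2 * (n - 1) ≤ ∑ a, 2 * δ a then cumulantBound n κ α (lam δ) N 0 δ else 0) := by
    intro δ
    have hKs : ∀ (v : Fin n) (Yv : Fin (2 * δ v) → Fin n × Γ), replicaKer 𝕜 (K (δ v)) v Yv ≠ 0 → ∀ j, (Yv j).1 = v :=
      fun v Yv h j => replicaKer_support 𝕜 (K (δ v)) v Yv h j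
    by_cases hpos : ∃ a, 0 < δ a
    · obtain ⟨a, ha⟩ := hpos
      split_ifs with hle
      · have h := norm_kernel_zero_ursellOf_kernelVertex_le C' (Prod.fst : Fin n × Γ → Fin n) (fun b => replicaKer 𝕜 (K (δ b)) b)
          (fun X' => q X'.2) hC'' (fun X' => f X'.2) (fun Y' => g Y'.2) hκ (fun X' h => hf _ h) (fun Y' h => hg _ h) hG'
          (fun b => even_two_mul (δ b)) hKs (fun u => N (δ u)) (fun u => hN0 _)
          (fun u j a' => sum_filter_norm_replicaKer_le (K (δ u)) u (hN (δ u)) j a') hα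
          (fun ℓ X' => sum_norm_typeRestrict_submatrix_le C hα hrow ℓ X') (fun ℓ Y' => sum_norm_typeRestrict_submatrix_le' C hα hcol ℓ Y')
          (hlam δ) a ⟨0, by omega⟩
        rw [hU]
        refine h.trans (le_of_eq ?_)
        rw [Fintype.card_prod, Fintype.card_fin, Nat.cast_mul, cumulantBound, Nat.factorial_zero, Nat.cast_one, inv_one, one_mul,
          Nat.descFactorial_zero, Nat.cast_one, one_mul, zero_add]
      · rw [hU]
        dsimp only
        rw [kernel_ursellOf_kernelVertex_eq_zero_of_lt C' (Prod.fst : Fin n × Γ → Fin n) (fun b => replicaKer 𝕜 (K (δ b)) b)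
          (fun X' => q X'.2) hC'' (fun X' => f X'.2) (fun Y' => g Y'.2) hκ (fun X' h => hf _ h) (fun Y' h => hg _ h) hG'
          (fun b => even_two_mul (δ b)) hKs ⟨0, hn⟩ (by omega) Fin.elim0, norm_zero, mul_zero]
    · -- all degrees vanish: the vertices are the zero kernel
      have hδ0 : ∀ a, δ a = 0 := fun a => Nat.eq_zero_of_not_pos fun h => hpos ⟨a, h⟩
      have hzero : U δ = 0 := by
        rw [hU]
        refine ursellOf_convMoment_eq_zero_of_eq_zero C' (Prod.fst : Fin n × Γ → Fin n)
          (fun b => coe_kernelVertex_mem 𝕜 Prod.fst _ _ hKs b) (v₀ := ⟨0, hn⟩) ?_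
        rw [kernelVertex]
        refine sum_eq_zero fun Yv _ => ?_
        have hK' : replicaKer 𝕜 (K (δ ⟨0, hn⟩)) ⟨0, hn⟩ Yv = 0 := by
          rw [replicaKer]
          split_ifs
          · generalize hm : δ ⟨0, hn⟩ = m at Yv
            rw [hδ0] at hm
            subst hm
            exact hK0 _
          · rfl
        rw [hK', zero_smul]
      rw [hzero, ZeroMemClass.coe_zero, kernel_zero_right, norm_zero]
      refine mul_nonneg (by positivity) ?_
      split_ifs
      · exact cumulantBound_nonneg hκ hα (hlam δ) (fun m' => hN0 m') 0 δ
      · exact le_rfl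
  -- assemble
  calc ‖constPart 𝕜 ((cumulantOf (fun k => evenGaussConv 𝕜 C (vertexOf 𝕜 degs K ^ k)) n : evenPart 𝕜 Γ) : GrassmannAlgebra 𝕜 Γ)‖
      ≤ ∑ δ ∈ Fintype.piFinset (fun _ : Fin n => degs), ‖kernel 𝕜 (U δ : GrassmannAlgebra 𝕜 (Fin n × Γ)) 0 Fin.elim0‖ := by
        rw [hcum, map_sum]
        refine (norm_sum_le _ _).trans (le_of_eq (sum_congr rfl fun δ _ => ?_))
        rw [constPart_collapse, kernel_zero]
    _ ≤ ∑ δ ∈ Fintype.piFinset (fun _ : Fin n => degs),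
          ((n : ℝ) * Fintype.card Γ) * (if 2 * (n - 1) ≤ ∑ a, 2 * δ a then cumulantBound n κ α (lam δ) N 0 δ else 0) :=
        sum_le_sum fun δ _ => hδ δ
    _ = ((n : ℝ) * Fintype.card Γ) * ∑ δ ∈ Fintype.piFinset (fun _ : Fin n => degs),
          (if 2 * (n - 1) ≤ ∑ a, 2 * δ a then cumulantBound n κ α (lam δ) N 0 δ else 0) := by rw [mul_sum]

end Cumulant

end Literature.MathematicalPhysics.QuantumLattice
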